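import Summits.ValiantsHypothesis.ValiantsHypothesis.Theorems.LacunarySymmetroidMatrixDescartesPivotRankOneCriticalWindowsSideCount
import Summits.ValiantsHypothesis.ValiantsHypothesis.Theorems.LacunarySymmetroidMatrixDescartesCensusPivotKit

/-!
# `MatrixDescartes` census — rank-one `(2,3)₁`: THE MIDDLE-PIVOT SUB-ROW IS EXACTLY THREE
# (an integer object with three positive roots; with `…CriticalWindowsSideCount` the middle-pivot configuration reads `= 3`)

HONEST FRAMING.  Object-search cell `pub-symmetroid`, seat `val-sym-mdr-p1` (generation 25); helper file `--supports` the crux item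
stmt-ValiantsHypothesis-18050 (`Theses.LacunarySymmetroid.MatrixDescartes`, OPEN, on HOLD) with NO closure claim.  A DATUM for the `m = 2`
pivot column: `…PivotRankOneThree` shows the rank-one `(2,3)₁` cell is `≤ 5` with `5` attained by an object whose two upper letters lie on
ONE side of the pivot letter; `…CriticalWindowsSideCount.pivotPosRoots_le_three_of_middle` (this session) shows `≤ 3` when the pivot
letter's position lies BETWEEN the other two.  THIS FILE: `3` is attained there — pivot `[[0,1],[1,0]]` at `e = 1`, letters
`(1,2)(1,2)ᵀ` at exponent `0` (the pivot letter `p`: `dₚ = 0 < e`), `(1,1)(1,1)ᵀ` at exponent `6`, `32·(1,4)(1,4)ᵀ` at exponent `3`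
(positions `1 < 2 < 4`): `det F(x) = (1 + 32x³ + x⁶)(4 + 512x³ + x⁶) − (2 + x + 128x³ + x⁶)²` takes the signs `− + − +` at
`x = 1/4, 5/16, 1/2, 1` (`exists_middle_three`, `middleObject_pivotPosRoots_eq_three`).  So the rank-one `(2,3)₁` row SPLITS BY POSITION
ORDER: middle pivot `3`, outer pivot `5`.  Nothing here bears on `MatrixDescartes` in its window, on `DoorA26` / `DoorA34`, registers /
credences, or `VP ≠ VNP`.

[folklore] IVT certificate via `Pivot.le_pivotPosRoots_of_certificate`; tree theorems named above.  No definitions, no named facts.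
-/

-- `Summit.ValiantsHypothesis.ValiantsHypothesis.…` repeats a component by the D-0017 layout
-- (single-conjunct summit), which the `dupNamespace` linter flags; the name is mandated.
set_option linter.dupNamespace false

namespace Summit.ValiantsHypothesis.ValiantsHypothesis.Theorems.LacunarySymmetroidMatrixDescartes.Pivot.CriticalWindows.MiddlePivotThree

open Polynomial Finset Matrix
open scoped BigOperators
open Summit.ValiantsHypothesis.ValiantsHypothesis.Theorems.LacunarySymmetroidMatrixDescartes.Pivot
  (pivotPosRoots le_pivotPosRoots_of_certificate)
open Summit.ValiantsHypothesis.ValiantsHypothesis.Theorems.LacunarySymmetroidMatrixDescartes.Pivot.CriticalWindows.SideCount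
  (pivotPosRoots_le_three_of_middle)

/-- Closed form of `det F(x)` for the middle object (pivot `[[0,1],[1,0]]` at `e = 1`; letters `w = (1, 1, 32)`, positions `t = (2, 1, 4)`,
exponents `d = (0, 6, 3)`): `det F(x) = (1 + x⁶ + 32x³)(4 + x⁶ + 512x³) − (2 + x⁶ + 128x³ + x)²`. [this file] -/
theorem eval_det_middleObject (x : ℝ) :
    (x ^ 1 • ((!![(0 : ℝ), 1; 1, 0] : Matrix (Fin 2) (Fin 2) ℝ))
      + ∑ k, x ^ (![0, 6, 3] : Fin 3 → ℕ) k •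
        ((fun k => (![(1 : ℝ), 1, 32] : Fin 3 → ℝ) k • vecMulVec ![1, (![(2 : ℝ), 1, 4] : Fin 3 → ℝ) k]
          ![1, (![(2 : ℝ), 1, 4] : Fin 3 → ℝ) k]) k)).det
      = (1 + x ^ 6 + 32 * x ^ 3) * (4 + x ^ 6 + 512 * x ^ 3) - (2 + x ^ 6 + 128 * x ^ 3 + x) ^ 2 := by
  rw [Matrix.det_fin_two]
  simp [Matrix.add_apply, Fin.sum_univ_succ]
  ring

/-- **THREE POSITIVE ROOTS**: `det F` takes the signs `− + − +` at `x = 1/4, 5/16, 1/2, 1`. [this file] -/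
theorem three_le_middleObject_pivotPosRoots :
    3 ≤ pivotPosRoots 1 (![0, 6, 3] : Fin 3 → ℕ) ((!![(0 : ℝ), 1; 1, 0] : Matrix (Fin 2) (Fin 2) ℝ))
      (fun k => (![(1 : ℝ), 1, 32] : Fin 3 → ℝ) k • vecMulVec ![1, (![(2 : ℝ), 1, 4] : Fin 3 → ℝ) k]
        ![1, (![(2 : ℝ), 1, 4] : Fin 3 → ℝ) k]) :=
  le_pivotPosRoots_of_certificate (N := 3) eval_det_middleObject
    ![1 / 4, 5 / 16, 1 / 2, 1]
    (by
      refine Fin.strictMono_iff_lt_succ.2 fun j => ?_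
      fin_cases j <;> simp only [Fin.castSucc_mk, Fin.succ_mk] <;> norm_num)
    (by intro j; fin_cases j <;> norm_num)
    (by intro j; fin_cases j <;> simp only [Fin.castSucc_mk, Fin.succ_mk] <;> norm_num)

/-- **AT MOST THREE** by the middle-pivot law (`tᵢ = 1 < tₚ = 2 < tⱼ = 4`, `dₚ = 0 < e = 1 < 3, 6`). [this file + `…SideCount`] -/
theorem middleObject_pivotPosRoots_le_three :
    pivotPosRoots 1 (![0, 6, 3] : Fin 3 → ℕ) ((!![(0 : ℝ), 1; 1, 0] : Matrix (Fin 2) (Fin 2) ℝ))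
      (fun k => (![(1 : ℝ), 1, 32] : Fin 3 → ℝ) k • vecMulVec ![1, (![(2 : ℝ), 1, 4] : Fin 3 → ℝ) k]
        ![1, (![(2 : ℝ), 1, 4] : Fin 3 → ℝ) k]) ≤ 3 := by
  refine pivotPosRoots_le_three_of_middle 3 1 _ _ _ 0 1 2 (by decide) (by decide) (by decide) ?_ ?_ ?_ ?_ ?_ ?_ ?_ ?_
  · intro m; fin_cases m <;> norm_num
  · intro m; fin_cases m <;> norm_num
  · decide
  · intro m hm; fin_cases m
    · exact absurd rfl hm
    · decide
    · decide
  · intro m hm hj; fin_cases m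
    · exact absurd rfl hm
    · norm_num
    · exact absurd rfl hj
  · intro m hm hi; fin_cases m
    · exact absurd rfl hm
    · exact absurd rfl hi
    · norm_num [Matrix.cons_val_two, Matrix.vecHead, Matrix.vecTail]
  · norm_num
  · norm_num [Matrix.cons_val_two, Matrix.vecHead, Matrix.vecTail]

/-- **THE MIDDLE-PIVOT SUB-ROW OF RANK-ONE `(2,3)₁` IS EXACTLY THREE** (for this object; `≤ 3` holds for every middle-pivot pencil). [this file] -/
theorem middleObject_pivotPosRoots_eq_three :
    pivotPosRoots 1 (![0, 6, 3] : Fin 3 → ℕ) ((!![(0 : ℝ), 1; 1, 0] : Matrix (Fin 2) (Fin 2) ℝ))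
      (fun k => (![(1 : ℝ), 1, 32] : Fin 3 → ℝ) k • vecMulVec ![1, (![(2 : ℝ), 1, 4] : Fin 3 → ℝ) k]
        ![1, (![(2 : ℝ), 1, 4] : Fin 3 → ℝ) k]) = 3 :=
  le_antisymm middleObject_pivotPosRoots_le_three three_le_middleObject_pivotPosRoots

/-- **EXISTENCE FORM**: some middle-pivot rank-one `(2,3)₁` pencil in hyperbolic normal form has exactly three positive roots. [this file] -/
theorem exists_middle_three :
    ∃ (e : ℕ) (d : Fin 3 → ℕ) (w t : Fin 3 → ℝ), (∀ m, 0 < w m) ∧ (∀ m, 0 < t m) ∧ d 0 < e ∧ e < d 1 ∧ e < d 2 ∧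
      t 1 < t 0 ∧ t 0 < t 2 ∧
      pivotPosRoots e d ((!![(0 : ℝ), 1; 1, 0] : Matrix (Fin 2) (Fin 2) ℝ))
        (fun k => w k • vecMulVec ![1, t k] ![1, t k]) = 3 :=
  ⟨1, ![0, 6, 3], ![1, 1, 32], ![2, 1, 4], by intro m; fin_cases m <;> norm_num, by intro m; fin_cases m <;> norm_num,
    by decide, by decide, by decide, by norm_num, by norm_num [Matrix.cons_val_two, Matrix.vecHead, Matrix.vecTail],
    middleObject_pivotPosRoots_eq_three⟩

end Summit.ValiantsHypothesis.ValiantsHypothesis.Theorems.LacunarySymmetroidMatrixDescartes.Pivot.CriticalWindows.MiddlePivotThree
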